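import Mathlib
import Literature.NumberTheory.EllipticCurves.KatoTwistedFiniteness
import HarnessLib

/-!
# BirchSwinnertonDyer / PlecticLegs — support item `KatoDescent` (stmt-BirchSwinnertonDyer-18262):
# group-ring algebra behind the Galois descent of the rank

Kato's Cor. 14.3 (2) (Astérisque 295) delivers, for a character `χ` of `G = Gal(ℚ(ζ_m)/ℚ)`, the
finiteness of the `χ`-part `M^(χ) = {x ; I_χ · x = 0}` (`Literature.NumberTheory.EllipticCurves.chiPart`)
of the Mordell–Weil group `M = E(ℚ(ζ_m))`. The route item `KatoDescent` needs the RANK statement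
`rank M^H = rank M^G` for a subgroup `H ≤ G`. This file is the elementary algebra (no elliptic
curves) used to manufacture, out of an additive "eigen-functional" `φ : M →+ ℂ`
(`φ (g x) = χ(g) φ(x)`), an element of `M^(χ)` on which `φ` does not vanish:

* an additive action `ρ : G → (M →+ M)` of a commutative group (unbundled, as in `chiPart`);
* `sum_subgroup_*` — the norm `N_C x = ∑_{c ∈ C} c x` over a finite subgroup `C`;
* `aeval_toIntLinearMap_apply` and friends — integer polynomials in one operator `ρ g₀`;
* `mem_chiPart_of_cyclotomic` — if `χ(G)` is generated by `χ(g₀)`, a primitive `n`-th root of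
  unity, then every `ker χ`-invariant `w` killed by `Φ_n(ρ g₀)` lies in `M^(χ)` (reduction of
  `ℤ[G]` modulo `ker χ` to `ℤ[X]/(Φ_n)`, `Φ_n` = minimal polynomial of `χ(g₀)` over `ℤ`);
* `apply_witness_eq` — the value of an eigen-functional on the witness
  `w = N_{ker χ}(Ψ_n(ρ g₀) x)`, `Ψ_n = ∏_{d ∣ n, d < n} Φ_d`, is `|ker χ| · Ψ_n(χ g₀) · φ x`, and
  `Ψ_n(χ g₀) ≠ 0`.

All statements are folklore (character theory of finite abelian groups over `ℤ`).
-/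

set_option linter.dupNamespace false

noncomputable section

open scoped BigOperators Classical
open Polynomial Literature.NumberTheory.EllipticCurves

namespace Summit.BirchSwinnertonDyer.BirchSwinnertonDyer.Theorems

namespace KatoDescent

variable {M : Type*} [AddCommGroup M] {G : Type*} [CommGroup G]
  (ρ : G → M →+ M) (hmul : ∀ (g h : G) (x : M), ρ (g * h) x = ρ g (ρ h x))
  (hone : ∀ x : M, ρ 1 x = x)

/-! ### Powers of one operator and integer polynomials in it -/

section OneOperator

include hmul hone in
/-- `(ρ g)^j = ρ (g^j)` for an action `ρ`. [folklore] -/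
theorem pow_toIntLinearMap_apply (g : G) (j : ℕ) (x : M) :
    ((ρ g).toIntLinearMap ^ j) x = ρ (g ^ j) x := by
  induction j generalizing x with
  | zero => simp [hone]
  | succ j ih => rw [pow_succ, Module.End.mul_apply, pow_succ, hmul, ← ih]; rfl

include hmul hone in
/-- An integer polynomial `p` in the operator `ρ g`, applied to `x`, is `∑ᵢ pᵢ • ρ(gⁱ) x`.
[folklore] -/
theorem aeval_toIntLinearMap_apply (g : G) (p : ℤ[X]) (x : M) :
    aeval (ρ g).toIntLinearMap p x =
      ∑ i ∈ Finset.range (p.natDegree + 1), p.coeff i • ρ (g ^ i) x := by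
  rw [aeval_eq_sum_range, LinearMap.coe_sum, Finset.sum_apply]
  refine Finset.sum_congr rfl fun i _ => ?_
  rw [LinearMap.smul_apply, pow_toIntLinearMap_apply ρ hmul hone]

include hmul hone in
/-- The operators `ρ c` commute with every integer polynomial in `ρ g` (`G` is commutative).
[folklore] -/
theorem apply_aeval_toIntLinearMap (c g : G) (p : ℤ[X]) (x : M) :
    ρ c (aeval (ρ g).toIntLinearMap p x) = aeval (ρ g).toIntLinearMap p (ρ c x) := by
  rw [aeval_toIntLinearMap_apply ρ hmul hone, aeval_toIntLinearMap_apply ρ hmul hone, map_sum]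
  refine Finset.sum_congr rfl fun i _ => ?_
  rw [map_zsmul, ← hmul, ← hmul, mul_comm]

include hmul hone in
/-- `(X^n - 1)(ρ g) x = ρ(g^n) x - x`. [folklore] -/
theorem aeval_X_pow_sub_one_apply (g : G) (n : ℕ) (x : M) :
    aeval (ρ g).toIntLinearMap (X ^ n - 1 : ℤ[X]) x = ρ (g ^ n) x - x := by
  simp only [map_sub, map_pow, aeval_X, map_one, LinearMap.sub_apply, Module.End.one_apply]
  rw [pow_toIntLinearMap_apply ρ hmul hone]

include hmul hone in
/-- **Eigen-functionals see polynomials in `ρ g` as scalars**: if `φ (ρ g x) = ζ φ(x)` for all `x`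
then `φ (p(ρ g) x) = p(ζ) φ(x)`. [folklore] -/
theorem apply_aeval_eq_aeval_mul (φ : M →+ ℂ) (g : G) (ζ : ℂ)
    (hφ : ∀ x : M, φ (ρ g x) = ζ * φ x) (p : ℤ[X]) (x : M) :
    φ (aeval (ρ g).toIntLinearMap p x) = aeval ζ p * φ x := by
  have hpow : ∀ (i : ℕ) (y : M), φ (ρ (g ^ i) y) = ζ ^ i * φ y := by
    intro i
    induction i with
    | zero => intro y; simp [hone]
    | succ i ih => intro y; rw [pow_succ, hmul, ih, hφ, pow_succ]; ring
  rw [aeval_toIntLinearMap_apply ρ hmul hone, map_sum, aeval_eq_sum_range, Finset.sum_mul]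
  refine Finset.sum_congr rfl fun i _ => ?_
  rw [map_zsmul, hpow, zsmul_eq_mul, zsmul_eq_mul]
  ring

end OneOperator

/-! ### The norm over a finite subgroup -/

section Norm

variable [Fintype G]

include hmul in
/-- The norm `N_C x = ∑_{c ∈ C} ρ(c) x` over a subgroup `C` is `C`-invariant. [folklore] -/
theorem apply_sum_subgroup (C : Subgroup G) {c : G} (hc : c ∈ C) (x : M) :
    ρ c (∑ d : C, ρ (d : G) x) = ∑ d : C, ρ (d : G) x := by
  rw [map_sum]
  simp_rw [← hmul]
  exact Fintype.sum_equiv (Equiv.mulLeft (⟨c, hc⟩ : C)) _ _ fun d => rfl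

include hmul in
/-- The norm over `C` absorbs `ρ(c)`, `c ∈ C`: `N_C (ρ c x) = N_C x`. [folklore] -/
theorem sum_subgroup_apply (C : Subgroup G) {c : G} (hc : c ∈ C) (x : M) :
    ∑ d : C, ρ (d : G) (ρ c x) = ∑ d : C, ρ (d : G) x := by
  simp_rw [← hmul]
  exact Fintype.sum_equiv (Equiv.mulRight (⟨c, hc⟩ : C)) _ _ fun d => rfl

/-- An eigen-functional with character trivial on `C` multiplies by `|C|` on the norm:
`φ (N_C x) = |C| φ(x)`. [folklore] -/
theorem apply_sum_subgroup_eq (C : Subgroup G) (φ : M →+ ℂ) (χ : G → ℂ)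
    (hφ : ∀ (g : G) (x : M), φ (ρ g x) = χ g * φ x) (hC : ∀ c ∈ C, χ c = 1) (x : M) :
    φ (∑ d : C, ρ (d : G) x) = (Fintype.card C : ℂ) * φ x := by
  rw [map_sum]
  simp_rw [hφ]
  rw [Finset.sum_congr rfl fun (d : C) _ => by rw [hC d d.2, one_mul], Finset.sum_const,
    Finset.card_univ, nsmul_eq_mul]

end Norm

/-! ### Membership in Kato's `χ`-part -/

section ChiPart

/-- **Reduction of `ℤ[G]` to `ℤ[X]/(Φ_n)`.** Let `χ : G → ℂˣ` be a character of the commutative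
group `G` whose image is generated by `ζ = χ(g₀)`, a primitive `n`-th root of unity, in the sense
that every `g` is `c · g₀^j` with `χ(c) = 1`. If `w ∈ M` is fixed by `ker χ` and killed by
`Φ_n(ρ g₀)`, then `w` lies in Kato's `χ`-part `M^(χ) = {x ; I_χ x = 0}`: an element
`a = ∑ a_g g` of `I_χ` acts on `w` as `p(ρ g₀)` with `p = ∑ a_g X^{j_g} ∈ ℤ[X]`, `p(ζ) = χ(a) = 0`,
so `Φ_n = minpoly_ℤ(ζ)` divides `p`. [folklore] -/
theorem mem_chiPart_of_cyclotomic (hmul : ∀ (g h : G) (x : M), ρ (g * h) x = ρ g (ρ h x))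
    (hone : ∀ x : M, ρ 1 x = x) (χ : G →* ℂˣ) {g₀ : G} {n : ℕ} (hn : 0 < n)
    (hζ : IsPrimitiveRoot (χ g₀ : ℂ) n)
    (hgen : ∀ g : G, ∃ c : G, χ c = 1 ∧ ∃ j : ℕ, g = c * g₀ ^ j) {w : M}
    (hwC : ∀ c : G, χ c = 1 → ρ c w = w)
    (hwΦ : aeval (ρ g₀).toIntLinearMap (cyclotomic n ℤ) w = 0) :
    w ∈ chiPart ρ (fun g => (χ g : ℂ)) := by
  choose c hc j hj using hgen
  set T := (ρ g₀).toIntLinearMap with hT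
  -- `ρ g w = T^{j g} w`
  have hρw : ∀ g : G, ρ g w = (T ^ j g) w := fun g => by
    rw [pow_toIntLinearMap_apply ρ hmul hone]
    conv_lhs => rw [hj g]
    rw [mul_comm, hmul, hwC (c g) (hc g)]
  -- `χ g = ζ ^ {j g}`
  have hχ : ∀ g : G, (χ g : ℂ) = (χ g₀ : ℂ) ^ j g := fun g => by
    conv_lhs => rw [hj g]
    rw [map_mul, hc g, one_mul, map_pow, Units.val_pow_eq_pow_val]
  intro a ha
  -- the polynomial `p = ∑ a_g X^{j g}`
  set p : ℤ[X] := ∑ g ∈ a.support, a g • X ^ j g with hp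
  have hpζ : aeval (χ g₀ : ℂ) p = 0 := by
    rw [hp, map_sum]
    simp_rw [map_zsmul, map_pow, aeval_X, ← hχ, zsmul_eq_mul]
    exact ha
  have hpT : aeval T p w = a.sum fun g k => k • ρ g w := by
    rw [hp, map_sum, LinearMap.coe_sum, Finset.sum_apply, Finsupp.sum]
    refine Finset.sum_congr rfl fun g _ => ?_
    rw [map_zsmul, map_pow, aeval_X, LinearMap.smul_apply, hρw]
  -- `Φ_n ∣ p` over `ℤ`
  have hint : IsIntegral ℤ (χ g₀ : ℂ) := hζ.isIntegral hn
  have hdvd : cyclotomic n ℤ ∣ p := by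
    rw [cyclotomic_eq_minpoly hζ hn]
    exact minpoly.isIntegrallyClosed_dvd hint hpζ
  obtain ⟨q, hq⟩ := hdvd
  rw [← hpT, hq, mul_comm, map_mul, Module.End.mul_apply, hwΦ, map_zero]

end ChiPart

/-! ### The witness `w = N_{ker χ} (Ψ_n(ρ g₀) x)` -/

section Witness

/-- `Φ_n · Ψ_n = X^n - 1` with `Ψ_n = ∏_{d ∣ n, d < n} Φ_d` (Mathlib
`prod_cyclotomic_eq_X_pow_sub_one`). [folklore] -/
theorem cyclotomic_mul_prod_properDivisors {n : ℕ} (hn : 0 < n) :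
    cyclotomic n ℤ * ∏ d ∈ n.properDivisors, cyclotomic d ℤ = X ^ n - 1 := by
  rw [← prod_cyclotomic_eq_X_pow_sub_one hn, ← Nat.insert_self_properDivisors hn.ne',
    Finset.prod_insert Nat.self_notMem_properDivisors]

/-- `Ψ_n(ζ) ≠ 0` for a primitive `n`-th root of unity `ζ` (`Φ_d(ζ) = 0` forces `ζ` to be a
primitive `d`-th root, `d = n`). [folklore] -/
theorem aeval_prod_properDivisors_ne_zero {n : ℕ} (hn : 0 < n) {ζ : ℂ}
    (hζ : IsPrimitiveRoot ζ n) :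
    aeval ζ (∏ d ∈ n.properDivisors, cyclotomic d ℤ) ≠ 0 := by
  rw [map_prod, Finset.prod_ne_zero_iff]
  intro d hd
  obtain ⟨hdn, hdlt⟩ := Nat.mem_properDivisors.mp hd
  have hd0 : d ≠ 0 := fun h => by
    rw [h, zero_dvd_iff] at hdn
    omega
  haveI : NeZero (d : ℂ) := ⟨Nat.cast_ne_zero.mpr hd0⟩
  rw [aeval_def, eval₂_eq_eval_map, map_cyclotomic, Ne, ← IsRoot.def, isRoot_cyclotomic_iff]
  exact fun h => hdlt.ne (h.unique hζ)

variable [Fintype G]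

include hmul hone in
/-- **The witness is killed by `Φ_n(ρ g₀)`**: for `x ∈ M`, `C ≤ G` a subgroup containing `g₀^n`,
`Φ_n(ρ g₀) (N_C (Ψ_n(ρ g₀) x)) = N_C ((ρ(g₀^n) - 1) x) = 0`. [folklore] -/
theorem aeval_cyclotomic_witness_eq_zero {n : ℕ} (hn : 0 < n) (g₀ : G) (C : Subgroup G)
    (hgn : g₀ ^ n ∈ C) (x : M) :
    aeval (ρ g₀).toIntLinearMap (cyclotomic n ℤ)
      (∑ d : C, ρ (d : G) (aeval (ρ g₀).toIntLinearMap
        (∏ d ∈ n.properDivisors, cyclotomic d ℤ) x)) = 0 := by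
  rw [map_sum]
  simp_rw [← apply_aeval_toIntLinearMap ρ hmul hone _ g₀ (cyclotomic n ℤ), ← Module.End.mul_apply,
    ← map_mul, cyclotomic_mul_prod_properDivisors hn, aeval_X_pow_sub_one_apply ρ hmul hone,
    map_sub, Finset.sum_sub_distrib, sum_subgroup_apply ρ hmul C hgn, sub_self]

include hmul in
/-- **The witness is `C`-invariant.** [folklore] -/
theorem apply_witness (C : Subgroup G) {c : G} (hc : c ∈ C) (y : M) :
    ρ c (∑ d : C, ρ (d : G) y) = ∑ d : C, ρ (d : G) y :=
  apply_sum_subgroup ρ hmul C hc y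

include hmul hone in
/-- **The eigen-functional on the witness**: if `φ (ρ g x) = χ(g) φ(x)`, `χ = 1` on `C` and
`χ(g₀) = ζ`, then `φ (N_C (Ψ_n(ρ g₀) x)) = |C| · Ψ_n(ζ) · φ(x)`. [folklore] -/
theorem apply_witness_eq (C : Subgroup G) (φ : M →+ ℂ) (χ : G → ℂ)
    (hφ : ∀ (g : G) (x : M), φ (ρ g x) = χ g * φ x) (hC : ∀ c ∈ C, χ c = 1) (g₀ : G) (n : ℕ)
    (x : M) :
    φ (∑ d : C, ρ (d : G) (aeval (ρ g₀).toIntLinearMap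
        (∏ d ∈ n.properDivisors, cyclotomic d ℤ) x)) =
      (Fintype.card C : ℂ) * (aeval (χ g₀) (∏ d ∈ n.properDivisors, cyclotomic d ℤ) * φ x) := by
  rw [apply_sum_subgroup_eq ρ C φ χ hφ hC,
    apply_aeval_eq_aeval_mul ρ hmul hone φ g₀ (χ g₀) (hφ g₀)]

end Witness

/-! ### Structure of a character of a finite commutative group -/

section Character

variable [Fintype G]

/-- **The image of a character is cyclic**: for `χ : G → ℂˣ` on a finite group there are `g₀` and
`n > 0` with `χ(g₀)` a primitive `n`-th root of unity and every `g` of the form `c · g₀^j`,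
`χ(c) = 1` (a finite subgroup of `ℂˣ` is cyclic, Mathlib `isCyclic_subgroup_units`). [folklore] -/
theorem exists_generator_of_character (χ : G →* ℂˣ) :
    ∃ (g₀ : G) (n : ℕ), 0 < n ∧ IsPrimitiveRoot (χ g₀ : ℂ) n ∧
      ∀ g : G, ∃ c : G, χ c = 1 ∧ ∃ j : ℕ, g = c * g₀ ^ j := by
  haveI : Finite χ.range := inferInstance
  haveI : IsCyclic χ.range := isCyclic_subgroup_units χ.range
  obtain ⟨s₀, hs₀⟩ := IsCyclic.exists_generator (α := χ.range)
  obtain ⟨g₀, hg₀⟩ : ∃ g₀ : G, χ g₀ = (s₀ : ℂˣ) := by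
    obtain ⟨g₀, hg₀⟩ := s₀.2
    exact ⟨g₀, hg₀⟩
  have hfin : IsOfFinOrder (χ g₀) := χ.isOfFinOrder (isOfFinOrder_of_finite g₀)
  refine ⟨g₀, orderOf (χ g₀), hfin.orderOf_pos, ?_, fun g => ?_⟩
  · exact (IsPrimitiveRoot.coe_units_iff).mpr (IsPrimitiveRoot.orderOf (χ g₀))
  · obtain ⟨k, hk⟩ := Subgroup.mem_zpowers_iff.mp (hs₀ ⟨χ g, g, rfl⟩)
    have hk' : (s₀ : ℂˣ) ^ k = χ g := by
      have := congrArg Subtype.val hk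
      simpa using this
    set j : ℕ := (k % (orderOf (χ g₀) : ℤ)).toNat with hj
    have hjk : χ g₀ ^ j = χ g := by
      rw [← hk', ← hg₀, ← zpow_natCast, hj,
        Int.toNat_of_nonneg (Int.emod_nonneg _ (by exact_mod_cast hfin.orderOf_pos.ne')),
        zpow_mod_orderOf]
    refine ⟨g * (g₀ ^ j)⁻¹, ?_, j, by group⟩
    rw [map_mul, map_inv, map_pow, hjk, mul_inv_cancel]

end Character

end KatoDescent

end Summit.BirchSwinnertonDyer.BirchSwinnertonDyer.Theorems

end
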